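import Summits.AtomisticToContinuum.HydrodynamicLimit.Theorems.InfluenceLocality.Negative.Certification

/-!
# `InfluenceLocality` (stmt-AtomisticToContinuum-13916) — served spheres: the matching lemma
and a reverse-Markov inequality

Sorry-free §G (first half) of the standing disprover's work file
`Cruxes/InfluenceLocality/Disproof.lean` (refuter-cdisprove-stmt-AtomisticToContinuum-13916-0,
2026-08-16). A sphere is SERVED if it is slow, isolated at range `max R 3σ · ℓ`, and aimed at by
an isolated partner (free flights `< ε` apart at `Tℓ/2`). Deterministically `#served ≤ #bad` on
the good set (`card_servedSet_le_badCount`: the certification lemma of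
`Negative/Certification.lean` in its sharp form `mem_badSet_or_of_isolated_overlap`, plus a
matching argument — slow isolated spheres are never partners and never share one, by a torus
triangle inequality in vector form); probabilistically the reverse-Markov inequality
`measure_sum_indicator_ge` for sums of indicators. The reductions of `CorruptionEvent` /
`PositiveBadFraction` to ONE static estimate are in `Negative/ServedReductions.lean`.
Nothing here asserts a Theses decl positively.
-/

namespace Summit.AtomisticToContinuum.HydrodynamicLimit.Theorems.InfluenceLocality.Negative

open MeasureTheory Set
open scoped Classical ENNReal
open Literature.Analysis.FluidPDE Literature.MathematicalPhysics.KineticTheory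
open Summit.AtomisticToContinuum.HydrodynamicLimit.Theses.AntiMazurCoboundaries (InfluenceLocality)

noncomputable section

/-! ## (G) ONE static estimate under both load-bearing claims: served spheres

A sphere `i` is SERVED (`Served`) if it is slow (`‖(Tℓ/2)·v_i‖ < (R′ℓ − 2ε)/2`,
`R′ = max R 3σ`), isolated at range `R′ℓ`, and some isolated partner `j` is aimed at it (free
flights `< ε` apart at `Tℓ/2`). Deterministically (certification + a matching argument: slow
isolated spheres cannot be partners and cannot share a partner), `#bad ≥ #served` on the good
set; probabilistically (reverse Markov), `G_N(#served ≥ p(N+1)/2) ≥ p/2` as soon as every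
sphere is served with probability `≥ p`. Hence `CorruptionEvent` AND `PositiveBadFraction` (so
`¬WithoutDelta` and `¬UniformInLam`) follow from the single static estimate `servedSphere_mass`
of §E. -/

section Served

/-- The bad set (the `Finset.filter` of the crux); `badCount` is its cardinality by `rfl`. -/
def badSet (σ T R : ℝ) (N : ℕ) (Φ : Flow σ N) (Ψ : ClusterFlows σ N)
    (z : Config (N + 1) (Fin 3) T3) : Finset (Fin (N + 1)) :=
  Finset.univ.filter fun i : Fin (N + 1) => ∃ t ∈ Set.Icc (0 : ℝ) (T * ell N),
      Φ.flow t z i ≠ localClusterState Ψ (R * ell N) t z i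

/-- `badCount` is the cardinality of `badSet`. [folklore] -/
theorem badCount_eq_card_badSet (σ T R : ℝ) (N : ℕ) (Φ : Flow σ N) (Ψ : ClusterFlows σ N)
    (z : Config (N + 1) (Fin 3) T3) : badCount σ T R N Φ Ψ z = (badSet σ T R N Φ Ψ z).card := rfl

/-- Membership in the bad set. [folklore] -/
theorem mem_badSet {σ T R : ℝ} {N : ℕ} {Φ : Flow σ N} {Ψ : ClusterFlows σ N}
    {z : Config (N + 1) (Fin 3) T3} {i : Fin (N + 1)} :
    i ∈ badSet σ T R N Φ Ψ z ↔ ∃ t ∈ Set.Icc (0 : ℝ) (T * ell N),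
      Φ.flow t z i ≠ localClusterState Ψ (R * ell N) t z i := by
  simp [badSet]

/-- SHARP CERTIFICATION: two isolated spheres whose free flights overlap inside the window —
one of THEM is bad. [folklore] -/
theorem mem_badSet_or_of_isolated_overlap {σ T R : ℝ} {N : ℕ} (Φ : Flow σ N)
    {Ψ : ClusterFlows σ N} (hΨ : SingletonFree Ψ) {z : Config (N + 1) (Fin 3) T3}
    (hz : z ∈ Φ.good) {i j : Fin (N + 1)} (hij : i ≠ j)
    (hi : ∀ k, k ≠ i → R * ell N < ‖(Torus.geometry (Fin 3)).sepVec (z i).1 (z k).1‖)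
    (hj : ∀ k, k ≠ j → R * ell N < ‖(Torus.geometry (Fin 3)).sepVec (z j).1 (z k).1‖)
    {t : ℝ} (ht0 : 0 ≤ t) (htT : t ≤ T * ell N)
    (hchart : ‖(Torus.geometry (Fin 3)).sepVec (z i).1 (z j).1‖ + ‖t • (z i).2 - t • (z j).2‖ < 1 / 2)
    (hoverlap : ‖(Torus.geometry (Fin 3)).sepVec (z i).1 (z j).1 + (t • (z i).2 - t • (z j).2)‖ <
      hsDiameter σ N) :
    i ∈ badSet σ T R N Φ Ψ z ∨ j ∈ badSet σ T R N Φ Ψ z := by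
  by_contra hno
  push Not at hno
  obtain ⟨hbi, hbj⟩ := hno
  rw [mem_badSet] at hbi hbj
  push Not at hbi hbj
  have hti := hbi t ⟨ht0, htT⟩
  have htj := hbj t ⟨ht0, htT⟩
  rw [localClusterState_of_isolated hΨ hi ht0] at hti
  rw [localClusterState_of_isolated hΨ hj ht0] at htj
  have hdom : Φ.flow t z ∈ hardSphereDomain (Torus.geometry (Fin 3)) (N + 1) (hsDiameter σ N) :=
    Φ.good_subset (Φ.mapsTo_good t hz)
  have hsep := hdom i j hij
  rw [hti, htj] at hsep
  dsimp only at hsep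
  rw [Torus.sepVec_translate_of_norm_lt hchart] at hsep
  exact (not_lt.2 hsep) hoverlap

/-- TORUS TRIANGLE (vector form): `dist(x, y) ≤ ‖sep(x, z) − sep(y, z)‖`. [folklore] -/
theorem norm_sepVec_le_norm_sepVec_sub (x y w : T3) :
    ‖(Torus.geometry (Fin 3)).sepVec x y‖ ≤
      ‖(Torus.geometry (Fin 3)).sepVec x w - (Torus.geometry (Fin 3)).sepVec y w‖ := by
  simp only [Torus.geometry_sepVec]
  have hxy : x - y = 0 + Literature.Analysis.FunctionSpaces.Torus.proj (Torus.reprSym (x - w) - Torus.reprSym (y - w)) := by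
    rw [show Literature.Analysis.FunctionSpaces.Torus.proj (Torus.reprSym (x - w) - Torus.reprSym (y - w)) =
        Literature.Analysis.FunctionSpaces.Torus.proj (Torus.reprSym (x - w)) -
          Literature.Analysis.FunctionSpaces.Torus.proj (Torus.reprSym (y - w)) from rfl,
      Torus.proj_reprSym, Torus.proj_reprSym]
    abel
  rw [hxy]
  simpa using Torus.norm_reprSym_add_proj_le (0 : T3) (Torus.reprSym (x - w) - Torus.reprSym (y - w))

/-- The isolation radius of the witness event: `R′ = max R 3σ` (so that slow spheres exist even
for `R < 2σ`). -/
abbrev capRange (σ R : ℝ) : ℝ := max R (3 * σ)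

/-- THE SERVED-PAIR EVENT for `(i, j)`: `i` and `j` isolated at range `R′ℓ`, free flights
`< ε` apart (in the chart) at `t = Tℓ/2`, and `i` SLOW: `‖t·v_i‖ < (R′ℓ − 2ε)/2`. -/
def CappedAimedPair (σ T R : ℝ) (N : ℕ) (i j : Fin (N + 1)) : Set (Config (N + 1) (Fin 3) T3) :=
  {z | (∀ k, k ≠ i → capRange σ R * ell N < ‖(Torus.geometry (Fin 3)).sepVec (z i).1 (z k).1‖) ∧
    (∀ k, k ≠ j → capRange σ R * ell N < ‖(Torus.geometry (Fin 3)).sepVec (z j).1 (z k).1‖) ∧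
    ‖(Torus.geometry (Fin 3)).sepVec (z i).1 (z j).1‖ +
        ‖(T * ell N / 2) • (z i).2 - (T * ell N / 2) • (z j).2‖ < 1 / 2 ∧
    ‖(Torus.geometry (Fin 3)).sepVec (z i).1 (z j).1 +
        ((T * ell N / 2) • (z i).2 - (T * ell N / 2) • (z j).2)‖ < hsDiameter σ N ∧
    ‖(T * ell N / 2) • (z i).2‖ < (capRange σ R * ell N - 2 * hsDiameter σ N) / 2}

/-- Sphere `i` is SERVED: some `j ≠ i` forms a served pair with it. -/
def Served (σ T R : ℝ) (N : ℕ) (i : Fin (N + 1)) : Set (Config (N + 1) (Fin 3) T3) :=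
  ⋃ j ∈ {j : Fin (N + 1) | j ≠ i}, CappedAimedPair σ T R N i j

/-- The length unit is positive. [folklore] -/
theorem ell_pos (N : ℕ) : 0 < ell N := Real.rpow_pos_of_pos (by positivity) _

/-- Isolation at range `R′ℓ` implies isolation at the forecast range `Rℓ`. [folklore] -/
theorem isolated_of_capRange {σ R : ℝ} {N : ℕ} {z : Config (N + 1) (Fin 3) T3} {i : Fin (N + 1)}
    (h : ∀ k, k ≠ i → capRange σ R * ell N < ‖(Torus.geometry (Fin 3)).sepVec (z i).1 (z k).1‖) :
    ∀ k, k ≠ i → R * ell N < ‖(Torus.geometry (Fin 3)).sepVec (z i).1 (z k).1‖ := fun k hk =>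
  lt_of_le_of_lt (mul_le_mul_of_nonneg_right (le_max_left _ _) (ell_pos N).le) (h k hk)

/-- On a served pair (and the good set), `i` or `j` is bad. [folklore] -/
theorem mem_badSet_or_of_cappedAimedPair {σ T R : ℝ} {N : ℕ} (hT : 0 ≤ T) (Φ : Flow σ N)
    {Ψ : ClusterFlows σ N} (hΨ : SingletonFree Ψ) {z : Config (N + 1) (Fin 3) T3}
    (hz : z ∈ Φ.good) {i j : Fin (N + 1)} (hij : i ≠ j) (h : z ∈ CappedAimedPair σ T R N i j) :
    i ∈ badSet σ T R N Φ Ψ z ∨ j ∈ badSet σ T R N Φ Ψ z := by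
  obtain ⟨hi, hj, hchart, hover, -⟩ := h
  have hℓ : 0 ≤ T * ell N := mul_nonneg hT (ell_pos N).le
  exact mem_badSet_or_of_isolated_overlap Φ hΨ hz hij (isolated_of_capRange hi)
    (isolated_of_capRange hj) (by positivity) (half_le_self hℓ) hchart hover

/-- NO SHARED PARTNERS: two slow isolated spheres aimed at by the same `j` coincide. [folklore] -/
theorem eq_of_cappedAimedPair_of_cappedAimedPair {σ T R : ℝ} {N : ℕ}
    {z : Config (N + 1) (Fin 3) T3} {i i' j : Fin (N + 1)}
    (h : z ∈ CappedAimedPair σ T R N i j) (h' : z ∈ CappedAimedPair σ T R N i' j) : i = i' := by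
  by_contra hne
  obtain ⟨hi, -, -, hover, hcap⟩ := h
  obtain ⟨-, -, -, hover', hcap'⟩ := h'
  set G := Torus.geometry (Fin 3)
  set t : ℝ := T * ell N / 2
  have hiso := hi i' (Ne.symm hne)
  -- R'ℓ < ‖sep(x_i, x_i')‖ ≤ ‖sep_ij - sep_i'j‖ ≤ ε + ε + ‖t v_i‖ + ‖t v_i'‖ < R'ℓ
  have htri := norm_sepVec_le_norm_sepVec_sub (z i).1 (z i').1 (z j).1
  have halg : G.sepVec (z i).1 (z j).1 - G.sepVec (z i').1 (z j).1 =
      (G.sepVec (z i).1 (z j).1 + (t • (z i).2 - t • (z j).2)) -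
        (G.sepVec (z i').1 (z j).1 + (t • (z i').2 - t • (z j).2)) - (t • (z i).2 - t • (z i').2) := by
    abel
  have hbound : ‖G.sepVec (z i).1 (z j).1 - G.sepVec (z i').1 (z j).1‖ <
      capRange σ R * ell N := by
    rw [halg]
    calc ‖(G.sepVec (z i).1 (z j).1 + (t • (z i).2 - t • (z j).2)) -
            (G.sepVec (z i').1 (z j).1 + (t • (z i').2 - t • (z j).2)) - (t • (z i).2 - t • (z i').2)‖
        ≤ ‖G.sepVec (z i).1 (z j).1 + (t • (z i).2 - t • (z j).2)‖ +
            ‖G.sepVec (z i').1 (z j).1 + (t • (z i').2 - t • (z j).2)‖ + (‖t • (z i).2‖ + ‖t • (z i').2‖) := by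
          refine (norm_sub_le _ _).trans (add_le_add ((norm_sub_le _ _).trans le_rfl) (norm_sub_le _ _))
      _ < hsDiameter σ N + hsDiameter σ N + ((capRange σ R * ell N - 2 * hsDiameter σ N) / 2 +
            (capRange σ R * ell N - 2 * hsDiameter σ N) / 2) := by
          gcongr
      _ = capRange σ R * ell N := by ring
  exact (lt_irrefl _) ((hiso.trans_le htri).trans hbound)

/-- SLOW ISOLATED SPHERES ARE NEVER PARTNERS: if `i` is in a served pair (as the slow sphere)
then no served pair has `i` as its partner. [folklore] -/
theorem not_cappedAimedPair_partner {σ T R : ℝ} {N : ℕ} {z : Config (N + 1) (Fin 3) T3}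
    {i j i' : Fin (N + 1)} (hii : i ≠ i') (h : z ∈ CappedAimedPair σ T R N i j)
    (h' : z ∈ CappedAimedPair σ T R N i' i) : False := by
  obtain ⟨-, -, -, -, hcap⟩ := h
  obtain ⟨hi', -, -, hover', hcap'⟩ := h'
  set G := Torus.geometry (Fin 3)
  set t : ℝ := T * ell N / 2
  have hiso := hi' i hii
  have halg : G.sepVec (z i').1 (z i).1 =
      (G.sepVec (z i').1 (z i).1 + (t • (z i').2 - t • (z i).2)) - t • (z i').2 + t • (z i).2 := by abel
  have hbound : ‖G.sepVec (z i').1 (z i).1‖ < capRange σ R * ell N := by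
    rw [halg]
    calc ‖G.sepVec (z i').1 (z i).1 + (t • (z i').2 - t • (z i).2) - t • (z i').2 + t • (z i).2‖
        ≤ ‖G.sepVec (z i').1 (z i).1 + (t • (z i').2 - t • (z i).2)‖ + ‖t • (z i').2‖ + ‖t • (z i).2‖ := by
          refine (norm_add_le _ _).trans (add_le_add ((norm_sub_le _ _).trans le_rfl) le_rfl)
      _ < hsDiameter σ N + (capRange σ R * ell N - 2 * hsDiameter σ N) / 2 +
            (capRange σ R * ell N - 2 * hsDiameter σ N) / 2 := by gcongr
      _ = capRange σ R * ell N - hsDiameter σ N := by ring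
      _ ≤ capRange σ R * ell N := sub_le_self _ (le_of_lt (by
          have := hover'.le; exact lt_of_le_of_lt (norm_nonneg _) hover'))
  exact (lt_irrefl _) (hiso.trans hbound)

end Served

section ServedCount

/-- The set of served spheres. -/
def servedSet (σ T R : ℝ) (N : ℕ) (z : Config (N + 1) (Fin 3) T3) : Finset (Fin (N + 1)) :=
  Finset.univ.filter fun i : Fin (N + 1) => z ∈ Served σ T R N i

/-- Membership in the served set. [folklore] -/
theorem mem_servedSet {σ T R : ℝ} {N : ℕ} {z : Config (N + 1) (Fin 3) T3} {i : Fin (N + 1)} :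
    i ∈ servedSet σ T R N z ↔ z ∈ Served σ T R N i := by
  simp [servedSet]

/-- Unfolding `Served`. [folklore] -/
theorem mem_served_iff {σ T R : ℝ} {N : ℕ} {z : Config (N + 1) (Fin 3) T3} {i : Fin (N + 1)} :
    z ∈ Served σ T R N i ↔ ∃ j, j ≠ i ∧ z ∈ CappedAimedPair σ T R N i j := by
  simp only [Served, Set.mem_iUnion, Set.mem_setOf_eq, exists_prop]

/-- **MATCHING LEMMA**: on the good set, `#served ≤ #bad` — pick for each served `i` a partner
`j(i)` and a bad sphere `b(i) ∈ {i, j(i)}` (certification); `b` is injective because slow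
isolated spheres are never partners and never share a partner. [folklore] -/
theorem card_servedSet_le_badCount {σ T R : ℝ} {N : ℕ} (hT : 0 ≤ T) (Φ : Flow σ N)
    {Ψ : ClusterFlows σ N} (hΨ : SingletonFree Ψ) {z : Config (N + 1) (Fin 3) T3}
    (hz : z ∈ Φ.good) : (servedSet σ T R N z).card ≤ badCount σ T R N Φ Ψ z := by
  classical
  have hpart : ∀ i ∈ servedSet σ T R N z, ∃ j, j ≠ i ∧ z ∈ CappedAimedPair σ T R N i j :=
    fun i hi => mem_served_iff.1 (mem_servedSet.1 hi)
  choose! jp hjp using hpart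
  have hbad : ∀ i ∈ servedSet σ T R N z, ∃ b, (b = i ∨ b = jp i) ∧ b ∈ badSet σ T R N Φ Ψ z := by
    intro i hi
    obtain ⟨hne, hmem⟩ := hjp i hi
    rcases mem_badSet_or_of_cappedAimedPair hT Φ hΨ hz (Ne.symm hne) hmem with h | h
    exacts [⟨i, Or.inl rfl, h⟩, ⟨jp i, Or.inr rfl, h⟩]
  choose! b hb using hbad
  rw [badCount_eq_card_badSet]
  refine Finset.card_le_card_of_injOn b (fun i hi => (hb i hi).2) ?_
  intro i hi i' hi' hEq
  rw [Finset.mem_coe] at hi hi'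
  obtain ⟨hbi, -⟩ := hb i hi
  obtain ⟨hbi', -⟩ := hb i' hi'
  obtain ⟨hne, hmem⟩ := hjp i hi
  obtain ⟨hne', hmem'⟩ := hjp i' hi'
  rcases hbi with h1 | h1 <;> rcases hbi' with h2 | h2
  · calc i = b i := h1.symm
      _ = b i' := hEq
      _ = i' := h2
  · exfalso
    have hji : jp i' = i := by rw [← h2, ← hEq, h1]
    rw [hji] at hmem' hne'
    exact not_cappedAimedPair_partner hne' hmem hmem'
  · exfalso
    have hji : jp i = i' := by rw [← h1, hEq, h2]
    rw [hji] at hmem hne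
    exact not_cappedAimedPair_partner hne hmem' hmem
  · have hjj : jp i = jp i' := by rw [← h1, hEq, h2]
    rw [hjj] at hmem
    exact eq_of_cappedAimedPair_of_cappedAimedPair hmem hmem'

/-- The served-pair event is measurable. [folklore] -/
theorem measurableSet_cappedAimedPair (σ T R : ℝ) (N : ℕ) (i j : Fin (N + 1)) :
    MeasurableSet (CappedAimedPair σ T R N i j) := by
  have hiso : ∀ i : Fin (N + 1), MeasurableSet {z : Config (N + 1) (Fin 3) T3 |
      ∀ k, k ≠ i → capRange σ R * ell N < ‖(Torus.geometry (Fin 3)).sepVec (z i).1 (z k).1‖} := by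
    intro i
    have hset : {z : Config (N + 1) (Fin 3) T3 |
        ∀ k, k ≠ i → capRange σ R * ell N < ‖(Torus.geometry (Fin 3)).sepVec (z i).1 (z k).1‖} =
        ⋂ (k : Fin (N + 1)) (_ : k ≠ i),
          {z | capRange σ R * ell N < ‖(Torus.geometry (Fin 3)).sepVec (z i).1 (z k).1‖} := by
      ext z; simp only [Set.mem_setOf_eq, Set.mem_iInter]
    rw [hset]
    exact MeasurableSet.iInter fun k => MeasurableSet.iInter fun _ =>
      measurableSet_lt measurable_const (measurable_sepVec_coord i k).norm
  refine (hiso i).inter ((hiso j).inter (MeasurableSet.inter ?_ (MeasurableSet.inter ?_ ?_)))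
  · exact measurableSet_lt ((measurable_sepVec_coord i j).norm.add
      (measurable_relVel_coord _ i j).norm) measurable_const
  · exact measurableSet_lt ((measurable_sepVec_coord i j).add (measurable_relVel_coord _ i j)).norm
      measurable_const
  · have hv : Measurable fun z : Config (N + 1) (Fin 3) T3 => (T * ell N / 2) • (z i).2 :=
      ((measurable_pi_apply i : Measurable fun z : Config (N + 1) (Fin 3) T3 => z i).snd).const_smul
        (T * ell N / 2)
    exact measurableSet_lt hv.norm measurable_const

/-- `Served i` is measurable. [folklore] -/
theorem measurableSet_served (σ T R : ℝ) (N : ℕ) (i : Fin (N + 1)) :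
    MeasurableSet (Served σ T R N i) :=
  MeasurableSet.biUnion (Set.to_countable _) fun j _ => measurableSet_cappedAimedPair σ T R N i j

/-- The served count as a sum of indicators (for integration). [folklore] -/
theorem sum_indicator_served_eq_card {σ T R : ℝ} {N : ℕ} (z : Config (N + 1) (Fin 3) T3) :
    (∑ i : Fin (N + 1), (Served σ T R N i).indicator (fun _ => (1 : ℝ≥0∞)) z) =
      ((servedSet σ T R N z).card : ℝ≥0∞) := by
  classical
  simp only [Set.indicator_apply, servedSet]
  rw [Finset.sum_boole]

/-- **REVERSE MARKOV** for a sum of indicators: if each of the `n ≥ 1` events has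
probability `≥ p`, then with probability `≥ p/2` at least `(p/2)·n` of them occur. [folklore] -/
theorem measure_sum_indicator_ge {Ω ι : Type*} [MeasurableSpace Ω] [Fintype ι] [Nonempty ι]
    (μ : Measure Ω) [IsProbabilityMeasure μ] {S : ι → Set Ω} (hS : ∀ i, MeasurableSet (S i))
    {p : ℝ≥0∞} (hp : ∀ i, p ≤ μ (S i)) :
    p / 2 ≤ μ {ω | p / 2 * (Fintype.card ι : ℝ≥0∞) ≤ ∑ i, (S i).indicator (fun _ => (1 : ℝ≥0∞)) ω} := by
  classical
  obtain ⟨i₀⟩ := ‹Nonempty ι›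
  set n : ℝ≥0∞ := (Fintype.card ι : ℝ≥0∞) with hn
  set f : Ω → ℝ≥0∞ := fun ω => ∑ i, (S i).indicator (fun _ => (1 : ℝ≥0∞)) ω with hf
  have hp1 : p ≤ 1 := (hp i₀).trans prob_le_one
  have hptop : p ≠ ∞ := ne_top_of_le_ne_top ENNReal.one_ne_top hp1
  have hn0 : n ≠ 0 := by
    rw [hn, Nat.cast_ne_zero]
    exact Fintype.card_ne_zero
  have hntop : n ≠ ∞ := ENNReal.natCast_ne_top _
  have hEm : MeasurableSet {ω | p / 2 * n ≤ f ω} :=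
    measurableSet_le measurable_const (Finset.measurable_sum _ fun i _ => measurable_const.indicator (hS i))
  -- lower bound on the mean
  have hlow : n * p ≤ ∫⁻ ω, f ω ∂μ := by
    calc n * p = ∑ _i : ι, p := by
          rw [Finset.sum_const, Finset.card_univ, nsmul_eq_mul]
      _ ≤ ∑ i, μ (S i) := Finset.sum_le_sum fun i _ => hp i
      _ = ∑ i, ∫⁻ ω, (S i).indicator (fun _ => (1 : ℝ≥0∞)) ω ∂μ := by
          refine Finset.sum_congr rfl fun i _ => ?_
          rw [lintegral_indicator_const (hS i), one_mul]
      _ = ∫⁻ ω, f ω ∂μ := (lintegral_finsetSum _ fun i _ => measurable_const.indicator (hS i)).symm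
  -- upper bound on the mean
  have hup : ∫⁻ ω, f ω ∂μ ≤ p / 2 * n + n * μ {ω | p / 2 * n ≤ f ω} := by
    have hpt : ∀ ω, f ω ≤ p / 2 * n + n * {ω | p / 2 * n ≤ f ω}.indicator (fun _ => (1 : ℝ≥0∞)) ω := by
      intro ω
      by_cases hω : p / 2 * n ≤ f ω
      · have hmem : ω ∈ {ω | p / 2 * n ≤ f ω} := hω
        have hfle : f ω ≤ n := by
          calc f ω = ∑ i, (S i).indicator (fun _ => (1 : ℝ≥0∞)) ω := rfl
            _ ≤ ∑ _i : ι, (1 : ℝ≥0∞) := Finset.sum_le_sum fun i _ =>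
                Set.indicator_apply_le' (fun _ => le_rfl) (fun _ => zero_le_one)
            _ = n := by rw [Finset.sum_const, Finset.card_univ, nsmul_eq_mul, mul_one]
        rw [Set.indicator_of_mem hmem, mul_one]
        exact hfle.trans le_add_self
      · have hnot : ω ∉ {ω | p / 2 * n ≤ f ω} := hω
        rw [Set.indicator_of_notMem hnot, mul_zero, add_zero]
        exact (not_le.1 hω).le
    calc ∫⁻ ω, f ω ∂μ ≤ ∫⁻ ω, (p / 2 * n + n * {ω | p / 2 * n ≤ f ω}.indicator (fun _ => (1 : ℝ≥0∞)) ω) ∂μ :=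
          lintegral_mono hpt
      _ = p / 2 * n + n * μ {ω | p / 2 * n ≤ f ω} := by
          rw [lintegral_add_left measurable_const, lintegral_const, measure_univ, mul_one,
            lintegral_const_mul _ (measurable_const.indicator hEm), lintegral_indicator_const hEm,
            one_mul]
  -- combine
  have hsplit : n * p = p / 2 * n + p / 2 * n := by
    rw [← add_mul, ENNReal.add_halves, mul_comm]
  have key : p / 2 * n + p / 2 * n ≤ p / 2 * n + n * μ {ω | p / 2 * n ≤ f ω} :=
    hsplit ▸ hlow.trans hup
  have hfin : p / 2 * n ≠ ∞ := ENNReal.mul_ne_top (ENNReal.div_ne_top hptop two_ne_zero) hntop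
  have key2 : p / 2 * n ≤ n * μ {ω | p / 2 * n ≤ f ω} := (ENNReal.add_le_add_iff_left hfin).1 key
  have key3 : n * (p / 2) ≤ n * μ {ω | p / 2 * n ≤ f ω} :=
    calc n * (p / 2) = p / 2 * n := mul_comm _ _
      _ ≤ _ := key2
  exact (ENNReal.mul_le_mul_iff_right hn0 hntop).1 key3

end ServedCount

end

end Summit.AtomisticToContinuum.HydrodynamicLimit.Theorems.InfluenceLocality.Negative
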